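import Literature.Probability.Percolation.FoldingFibresHarris
import Mathlib.Combinatorics.SetFamily.FourFunctions
import HarnessLib

/-!
# The four functions theorem holds fibre by fibre (Aharoni–Keich, Christofides, Chan–Pak)

Topic `Literature/Probability/Percolation` (configurations `Set ι`, `ι` finite; the folding fibres of
`FoldingFibres.lean` / `FoldingFibresHarris.lean`).  Theorems only: no definition of a notion, no
named fact.

`FoldingFibresHarris.lean` proves that Harris' inequality holds on every folding fibre
`F = {a : a \ M = u}` ("configuration versus its reflection `a ∆ M`").  This file proves the same for
the full **Ahlswede–Daykin four functions theorem**: if `f₁ f₂ f₃ f₄ : Set ι → ℝ` are nonnegative and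
`f₁ a · f₂ b ≤ f₃ (a ∩ b) · f₄ (a ∪ b)` for all `a, b`, then for EVERY folding fibre
`∑_{a ∈ F} f₁ a · f₂ (a ∆ M) ≤ ∑_{a ∈ F} f₃ a · f₄ (a ∆ M)` (`FoldingFibre.fourFunctions_fibre`);
the fibre `M = univ, u = ∅` is the whole cube with the reflection `a ↦ aᶜ`, giving the
**complementary-pairs four functions theorem** `∑_a f₁ a · f₂ aᶜ ≤ ∑_a f₃ a · f₄ aᶜ`
(`fourFunctions_compl`).  Corollaries: the four-EVENTS inequality is fibrewise
(`FoldingFibre.fibreCount_le_of_fourEvents`, in the exact shape consumed by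
`prodBernoulli_real_mul_le_of_fibrewise`), hence `μ(A₁) μ(A₂) ≤ μ(A₃) μ(A₄)` for every
`prodBernoulli p` re-derived through the folding identity (`prodBernoulli_fourEvents_via_fibres`;
the tree's `prodBernoulli_fourEvents` proves it directly), and the "Kleitman twice" count
`#{a ∈ 𝒟₁ : aᶜ ∈ 𝒟₂} ≤ #(𝒟₁ ∩ 𝒟₂)` for two lower sets (`card_filter_compl_mem_le_of_isLowerSet`) — the
two-part case of the ordered-partition inequalities studied in the harness's "fibre programme"
(three parts = Conjecture D of run/shared/lean/prim/prim-ineq-gen-5, open).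

## Sources, as printed

* D. Christofides, *A q-analogue of the four functions theorem*, arXiv:0909.5137 (2009),
  **Theorem 2.2**: "Let α,β,γ and δ be functions from 𝒫(n) to the set of non-negative reals satisfying
  α(A)β(B) ≤ γ(A∪B)δ(A∩B) for every A,B ∈ 𝒫(n). Then Σ_{A∈𝒫(n)} α(A)β(Aᶜ) ≤ Σ_{C∈𝒫(n)} γ(C)δ(Cᶜ)."
  and its §2 reduction "for each F,G ∈ 𝒫(n) … Σ_{A∩B=F, A∪B=G} α(A)β(B) ≤ Σ_{C∩D=F, C∪D=G} γ(C)δ(D)"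
  (apply Thm 2.2 on 𝒫(G∖F) to α′(A) = α(A∪F), …) — the statement on every (meet, join)-fibre;
  Theorem 1.5 = the q-analogue of the four functions theorem asked for by Björner.
* R. Aharoni, U. Keich, *A generalization of the Ahlswede–Daykin inequality*, Discrete Math. 152
  (1996) 1–12, **Proposition 4.4** (their level-wise Conjecture 4.3 holds for n = 2): under the AD
  hypothesis, for every level Λ = {(A,B) : A∪B = X, A∩B = Y}, Σ_Λ α¹(A)α²(B) ≤ Σ_Λ β¹(A)β²(B), proved
  by applying AD to α̃ⁱ(A) = αⁱ(A)·α^{3−i}(Y∪(X∖A)).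
* S. H. Chan, I. Pak, *Multivariate correlation inequalities for P-partitions*, Pacific J. Math. 323
  (2023) 223–252 = arXiv:2212.11954, Thm 6.1 (multivariate q-AD) and **Claim 6.3** with the proof used
  here: α′(x) := α(x)β(xᶜ), β′(x) := α(xᶜ)β(x), γ′(x) := γ(x)δ(xᶜ), δ′(x) := γ(xᶜ)δ(x) satisfy the AD
  hypothesis again (AD at (x,y) and at (yᶜ,xᶜ)), the usual AD inequality gives
  α′(L)β′(L) ≤ γ′(L)δ′(L), and α′(L) = β′(L), γ′(L) = δ′(L).
* A. Björner, *A q-analogue of the FKG inequality and some applications*, Combinatorica 31 (2011)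
  151–164 = arXiv:0906.1389, Thm 2.1 (q-FKG; Claim: ψ(u,v) ≥ 0 on every interval) and Thm 3.1
  (f_Δ(q) f_Γ(q) ≪ (1+q)^{|V|} f_{Δ∩Γ}(q) for two simplicial complexes; "for q = 1 the theorem
  specializes to a result of Kleitman").

## What is proved (Mathlib's orientation: `f₃` on the meet, `f₄` on the join)

* `FoldingFibre.symmDiff_inter_symmDiff`, `FoldingFibre.symmDiff_union_symmDiff` — on a fibre the
  reflection `a ↦ a ∆ M` is a lattice ANTI-morphism: `(a ∆ M) ∩ (b ∆ M) = (a ∪ b) ∆ M`,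
  `(a ∆ M) ∪ (b ∆ M) = (a ∩ b) ∆ M`.
* `FoldingFibre.fourFunctions_fibre` — the four functions theorem on every folding fibre
  (Christofides Thm 2.2 on `𝒫(M)` translated by `u`; = Chan–Pak Claim 6.3; = AK Prop 4.4).  Proof =
  the printed twist, fed to Mathlib's `four_functions_theorem_univ` on the distributive lattice
  `Set ι` with the twisted functions extended by `0` off the fibre.
* `fourFunctions_compl` — the complementary-pairs form (Christofides Thm 2.2 verbatim, `ι` finite).
* `FoldingFibre.fibreCount_le_of_fourEvents`, `prodBernoulli_fourEvents_via_fibres`,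
  `card_filter_compl_mem_le_of_isLowerSet` — corollaries listed above.

Harness context (2026-08): the k = 2 layer of the cell's "comb / fibre" statements (gen-1 P₂,
`TwoCopyFibre`, `ThreeCopy.hqt_nonneg_of_fibres`' two-copy analogue) is thereby a printed theorem in
the tree; the k = 3 layer (Richards-comb, M(HQT), Conjecture D, Aharoni–Keich's Conjecture 4.3 for
n = 3) is open in print (memo run/shared/lean/prim/prim-lit-4/LITERATURE-4.md §D10).

## References

* [Christofides2009] D. Christofides, A q-analogue of the four functions theorem, arXiv:0909.5137.
* [AharoniKeich1996] R. Aharoni, U. Keich, Discrete Math. 152 (1996) 1–12, Prop. 4.4, Conj. 4.3.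
* [ChanPak2023] S. H. Chan, I. Pak, Pacific J. Math. 323 (2023) 223–252, Thm 6.1, Claim 6.3.
* [Bjorner2011] A. Björner, Combinatorica 31 (2011) 151–164, Thm 2.1, Thm 3.1.
* [AhlswedeDaykin1978] R. Ahlswede, D. E. Daykin, Z. Wahrsch. 43 (1978) 183–185 (Mathlib
  `four_functions_theorem`).
* [Kleitman1966], [Linusson2011] as in `FoldingFibresHarris.lean` / `FoldingFibres.lean`.
-/

noncomputable section

open MeasureTheory Set
open scoped symmDiff Classical FinsetFamily
open Literature.Probability.LatticeModels (prodBernoulli)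

namespace Literature.Probability.Percolation

variable {ι : Type*} [Fintype ι]

namespace FoldingFibre

/-! ### The reflection is a lattice anti-morphism of the fibre -/

/-- On a folding fibre, `(a ∆ M) ∩ (b ∆ M) = (a ∪ b) ∆ M`. [folklore] -/
theorem symmDiff_inter_symmDiff {M u a b : Set ι} (ha : a ∈ fibre M u)
    (hb : b ∈ fibre M u) : (a ∆ M) ∩ (b ∆ M) = (a ∪ b) ∆ M := by
  rw [mem_fibre_iff] at ha hb
  ext x
  have h1 := ha x
  have h2 := hb x
  simp only [Set.mem_inter_iff, Set.mem_union, Set.mem_symmDiff]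
  tauto

/-- On a folding fibre, `(a ∆ M) ∪ (b ∆ M) = (a ∩ b) ∆ M`. [folklore] -/
theorem symmDiff_union_symmDiff {M u a b : Set ι} (ha : a ∈ fibre M u)
    (hb : b ∈ fibre M u) : (a ∆ M) ∪ (b ∆ M) = (a ∩ b) ∆ M := by
  rw [mem_fibre_iff] at ha hb
  ext x
  have h1 := ha x
  have h2 := hb x
  simp only [Set.mem_inter_iff, Set.mem_union, Set.mem_symmDiff]
  tauto

/-! ### The four functions theorem on a folding fibre -/

/-- **The four functions theorem holds on every folding fibre** (Christofides 2009 Thm 2.2 on the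
cube `𝒫(M)`, = Chan–Pak 2023 Claim 6.3, = Aharoni–Keich 1996 Prop. 4.4): if `f₁,…,f₄ ≥ 0` on
`Set ι` and `f₁ a · f₂ b ≤ f₃ (a ∩ b) · f₄ (a ∪ b)` for all `a, b`, then for every fibre
`F = {a : a \ M = u}` with its reflection `a ↦ a ∆ M`,
`∑_{a ∈ F} f₁ a · f₂ (a ∆ M) ≤ ∑_{a ∈ F} f₃ a · f₄ (a ∆ M)`.
Proof (the printed twist): `g₁ a = f₁ a f₂ (a ∆ M)`, `g₂ a = f₁ (a ∆ M) f₂ a`, `g₃ a = f₃ a f₄ (a ∆ M)`,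
`g₄ a = f₃ (a ∆ M) f₄ a` on `F` (and `0` off `F`) satisfy the AD hypothesis on the distributive lattice
`Set ι` (the hypothesis at `(a,b)` times the hypothesis at `(b ∆ M, a ∆ M)`, using that the reflection
is an anti-morphism of `F`); Mathlib's `four_functions_theorem_univ` gives
`(Σ g₁)(Σ g₂) ≤ (Σ g₃)(Σ g₄)`, and `Σ g₂ = Σ g₁`, `Σ g₄ = Σ g₃` by the involution.
[cite: Christofides2009, Thm 2.2 and §2 reduction] [cite: ChanPak2023, Claim 6.3]
[cite: AharoniKeich1996, Prop. 4.4] -/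
theorem fourFunctions_fibre (f₁ f₂ f₃ f₄ : Set ι → ℝ) (h₁ : ∀ a, 0 ≤ f₁ a) (h₂ : ∀ a, 0 ≤ f₂ a)
    (h₃ : ∀ a, 0 ≤ f₃ a) (h₄ : ∀ a, 0 ≤ f₄ a)
    (h : ∀ a b, f₁ a * f₂ b ≤ f₃ (a ∩ b) * f₄ (a ∪ b)) (M u : Set ι) :
    ∑ a ∈ fibre M u, f₁ a * f₂ (a ∆ M) ≤ ∑ a ∈ fibre M u, f₃ a * f₄ (a ∆ M) := by
  set F := fibre M u with hF
  -- the twisted functions, extended by zero off the fibre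
  set g₁ : Set ι → ℝ := fun a => if a ∈ F then f₁ a * f₂ (a ∆ M) else 0 with hg₁
  set g₂ : Set ι → ℝ := fun a => if a ∈ F then f₁ (a ∆ M) * f₂ a else 0 with hg₂
  set g₃ : Set ι → ℝ := fun a => if a ∈ F then f₃ a * f₄ (a ∆ M) else 0 with hg₃
  set g₄ : Set ι → ℝ := fun a => if a ∈ F then f₃ (a ∆ M) * f₄ a else 0 with hg₄
  have hg₁0 : 0 ≤ g₁ := fun a => by
    simp only [hg₁, Pi.zero_apply]
    split_ifs
    · exact mul_nonneg (h₁ _) (h₂ _)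
    · exact le_rfl
  have hg₂0 : 0 ≤ g₂ := fun a => by
    simp only [hg₂, Pi.zero_apply]
    split_ifs
    · exact mul_nonneg (h₁ _) (h₂ _)
    · exact le_rfl
  have hg₃0 : 0 ≤ g₃ := fun a => by
    simp only [hg₃, Pi.zero_apply]
    split_ifs
    · exact mul_nonneg (h₃ _) (h₄ _)
    · exact le_rfl
  have hg₄0 : 0 ≤ g₄ := fun a => by
    simp only [hg₄, Pi.zero_apply]
    split_ifs
    · exact mul_nonneg (h₃ _) (h₄ _)
    · exact le_rfl
  -- the AD hypothesis for the twisted quadruple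
  have key : ∀ a b, g₁ a * g₂ b ≤ g₃ (a ⊓ b) * g₄ (a ⊔ b) := by
    intro a b
    by_cases ha : a ∈ F
    · by_cases hb : b ∈ F
      · have hab : a ∩ b ∈ F := inter_mem_fibre ha hb
        have hab' : a ∪ b ∈ F := union_mem_fibre ha hb
        simp only [hg₁, hg₂, hg₃, hg₄, Set.inf_eq_inter, Set.sup_eq_union, if_pos ha, if_pos hb,
          if_pos hab, if_pos hab']
        have e1 := h a b
        have e2 := h (b ∆ M) (a ∆ M)
        rw [symmDiff_inter_symmDiff hb ha, symmDiff_union_symmDiff hb ha, Set.union_comm b a,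
          Set.inter_comm b a] at e2
        calc f₁ a * f₂ (a ∆ M) * (f₁ (b ∆ M) * f₂ b)
            = (f₁ a * f₂ b) * (f₁ (b ∆ M) * f₂ (a ∆ M)) := by ring
          _ ≤ (f₃ (a ∩ b) * f₄ (a ∪ b)) * (f₃ ((a ∪ b) ∆ M) * f₄ ((a ∩ b) ∆ M)) :=
              mul_le_mul e1 e2 (mul_nonneg (h₁ _) (h₂ _)) (mul_nonneg (h₃ _) (h₄ _))
          _ = f₃ (a ∩ b) * f₄ ((a ∩ b) ∆ M) * (f₃ ((a ∪ b) ∆ M) * f₄ (a ∪ b)) := by ring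
      · have : g₂ b = 0 := by simp only [hg₂, if_neg hb]
        rw [this, mul_zero]
        exact mul_nonneg (hg₃0 _) (hg₄0 _)
    · have : g₁ a = 0 := by simp only [hg₁, if_neg ha]
      rw [this, zero_mul]
      exact mul_nonneg (hg₃0 _) (hg₄0 _)
  have had := four_functions_theorem_univ g₁ g₂ g₃ g₄ hg₁0 hg₂0 hg₃0 hg₄0 key
  -- identify the four sums
  have s₁ : ∑ a, g₁ a = ∑ a ∈ F, f₁ a * f₂ (a ∆ M) := by
    rw [hg₁, Finset.sum_ite_mem, Finset.univ_inter]
  have s₃ : ∑ a, g₃ a = ∑ a ∈ F, f₃ a * f₄ (a ∆ M) := by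
    rw [hg₃, Finset.sum_ite_mem, Finset.univ_inter]
  have s₂ : ∑ a, g₂ a = ∑ a ∈ F, f₁ a * f₂ (a ∆ M) := by
    rw [hg₂, Finset.sum_ite_mem, Finset.univ_inter]
    refine Finset.sum_nbij' (fun a => a ∆ M) (fun a => a ∆ M) ?_ ?_ ?_ ?_ ?_
    · intro a ha; exact symmDiff_mem_fibre ha
    · intro a ha; exact symmDiff_mem_fibre ha
    · intro a _; exact symmDiff_symmDiff_cancel_right M a
    · intro a _; exact symmDiff_symmDiff_cancel_right M a
    · intro a _; rw [symmDiff_symmDiff_cancel_right, mul_comm]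
  have s₄ : ∑ a, g₄ a = ∑ a ∈ F, f₃ a * f₄ (a ∆ M) := by
    rw [hg₄, Finset.sum_ite_mem, Finset.univ_inter]
    refine Finset.sum_nbij' (fun a => a ∆ M) (fun a => a ∆ M) ?_ ?_ ?_ ?_ ?_
    · intro a ha; exact symmDiff_mem_fibre ha
    · intro a ha; exact symmDiff_mem_fibre ha
    · intro a _; exact symmDiff_symmDiff_cancel_right M a
    · intro a _; exact symmDiff_symmDiff_cancel_right M a
    · intro a _; rw [symmDiff_symmDiff_cancel_right, mul_comm]
  rw [s₁, s₂, s₃, s₄] at had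
  -- `S₁ · S₁ ≤ S₃ · S₃` with `S₃ ≥ 0` gives `S₁ ≤ S₃`
  have hS₃ : 0 ≤ ∑ a ∈ F, f₃ a * f₄ (a ∆ M) :=
    Finset.sum_nonneg fun a _ => mul_nonneg (h₃ _) (h₄ _)
  exact nonneg_le_nonneg_of_sq_le_sq hS₃ had

/-- **The four EVENTS theorem is fibrewise**: if `a ∩ b ∈ A₃` and `a ∪ b ∈ A₄` whenever `a ∈ A₁`,
`b ∈ A₂`, then on every folding fibre
`#{a : a \ M = u, a ∈ A₁, a ∆ M ∈ A₂} ≤ #{a : a \ M = u, a ∈ A₃, a ∆ M ∈ A₄}` — the indicator case of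
`fourFunctions_fibre`, in the shape consumed by `prodBernoulli_real_mul_le_of_fibrewise`.  Harris
fibrewise (`fibreCount_le_of_isUpperSet`) is the case `A₃ = A₁ ∩ A₂`, `A₄ = univ`.
[cite: Christofides2009, Thm 2.2] [cite: AharoniKeich1996, Prop. 4.4] -/
theorem fibreCount_le_of_fourEvents {A₁ A₂ A₃ A₄ : Set (Set ι)}
    (h : ∀ a ∈ A₁, ∀ b ∈ A₂, a ∩ b ∈ A₃ ∧ a ∪ b ∈ A₄) (M u : Set ι) :
    (Finset.univ.filter fun a : Set ι => a \ M = u ∧ a ∈ A₁ ∧ a ∆ M ∈ A₂).card ≤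
      (Finset.univ.filter fun a : Set ι => a \ M = u ∧ a ∈ A₃ ∧ a ∆ M ∈ A₄).card := by
  -- indicator functions
  let ind : Set (Set ι) → Set ι → ℝ := fun A a => if a ∈ A then 1 else 0
  have hind0 : ∀ A a, 0 ≤ ind A a := fun A a => by
    simp only [ind]; split_ifs <;> norm_num
  have hyp : ∀ a b, ind A₁ a * ind A₂ b ≤ ind A₃ (a ∩ b) * ind A₄ (a ∪ b) := by
    intro a b
    by_cases ha : a ∈ A₁
    · by_cases hb : b ∈ A₂
      · obtain ⟨h3, h4⟩ := h a ha b hb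
        simp only [ind, if_pos ha, if_pos hb, if_pos h3, if_pos h4, mul_one, le_refl]
      · simp only [ind, if_neg hb, mul_zero]
        exact mul_nonneg (hind0 _ _) (hind0 _ _)
    · simp only [ind, if_neg ha, zero_mul]
      exact mul_nonneg (hind0 _ _) (hind0 _ _)
  have hf := fourFunctions_fibre (ind A₁) (ind A₂) (ind A₃) (ind A₄) (hind0 _) (hind0 _) (hind0 _)
    (hind0 _) hyp M u
  -- both sides are counts
  have e : ∀ A B : Set (Set ι),
      ∑ a ∈ fibre M u, ind A a * ind B (a ∆ M) =
        ((Finset.univ.filter fun a : Set ι => a \ M = u ∧ a ∈ A ∧ a ∆ M ∈ B).card : ℝ) := by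
    intro A B
    have e1 : (Finset.univ.filter fun a : Set ι => a \ M = u ∧ a ∈ A ∧ a ∆ M ∈ B) =
        (fibre M u).filter fun a => a ∈ A ∧ a ∆ M ∈ B := by
      ext a
      simp [fibre]
    rw [e1, Finset.card_filter, Nat.cast_sum]
    refine Finset.sum_congr rfl fun a _ => ?_
    by_cases ha : a ∈ A <;> by_cases hb : a ∆ M ∈ B <;> simp [ind, ha, hb]
  rw [e A₁ A₂, e A₃ A₄] at hf
  exact_mod_cast hf

end FoldingFibre

/-! ### The complementary-pairs four functions theorem and corollaries -/

omit [Fintype ι] in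
/-- `a ∆ univ = aᶜ`. [folklore] -/
theorem symmDiff_univ_eq_compl (a : Set ι) : a ∆ (Set.univ : Set ι) = aᶜ := by
  ext x
  simp [Set.mem_symmDiff]

/-- The whole cube is the folding fibre `M = univ`, `u = ∅`. [folklore] -/
theorem FoldingFibre.fibre_univ_empty : FoldingFibre.fibre (Set.univ : Set ι) ∅ = Finset.univ := by
  ext a
  simp [FoldingFibre.fibre]

/-- **Complementary-pairs four functions theorem** (Christofides 2009, Thm 2.2; Aharoni–Keich 1996,
Prop. 4.4 at the level `(X,Y) = (univ, ∅)`): if `f₁,…,f₄ ≥ 0` on the cube `Set ι` (`ι` finite) and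
`f₁ a · f₂ b ≤ f₃ (a ∩ b) · f₄ (a ∪ b)` for all `a, b`, then
`∑_a f₁ a · f₂ aᶜ ≤ ∑_a f₃ a · f₄ aᶜ`.
[cite: Christofides2009, Thm 2.2] [cite: AharoniKeich1996, Prop. 4.4] [cite: ChanPak2023, Claim 6.3] -/
theorem fourFunctions_compl (f₁ f₂ f₃ f₄ : Set ι → ℝ) (h₁ : ∀ a, 0 ≤ f₁ a) (h₂ : ∀ a, 0 ≤ f₂ a)
    (h₃ : ∀ a, 0 ≤ f₃ a) (h₄ : ∀ a, 0 ≤ f₄ a)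
    (h : ∀ a b, f₁ a * f₂ b ≤ f₃ (a ∩ b) * f₄ (a ∪ b)) :
    ∑ a, f₁ a * f₂ aᶜ ≤ ∑ a, f₃ a * f₄ aᶜ := by
  have hf := FoldingFibre.fourFunctions_fibre f₁ f₂ f₃ f₄ h₁ h₂ h₃ h₄ h Set.univ ∅
  simp only [FoldingFibre.fibre_univ_empty, symmDiff_univ_eq_compl] at hf
  exact hf

/-- **Four events through the folding identity**: if `a ∩ b ∈ A₃` and `a ∪ b ∈ A₄` whenever
`a ∈ A₁` and `b ∈ A₂`, then `μ(A₁) μ(A₂) ≤ μ(A₃) μ(A₄)` for `μ = prodBernoulli p`, every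
`p : ι → [0,1]` — from `prodBernoulli_real_mul_le_of_fibrewise` and
`FoldingFibre.fibreCount_le_of_fourEvents` (same statement as the tree's `prodBernoulli_fourEvents`,
which is proved from Mathlib's four functions theorem with the product weights).
[cite: AhlswedeDaykin1978, Thm 1] [cite: Christofides2009, Thm 2.2] [cite: Linusson2011, Prop. 2.6] -/
theorem prodBernoulli_fourEvents_via_fibres (p : ι → unitInterval) {A₁ A₂ A₃ A₄ : Set (Set ι)}
    (h : ∀ a ∈ A₁, ∀ b ∈ A₂, a ∩ b ∈ A₃ ∧ a ∪ b ∈ A₄) :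
    (prodBernoulli p).real A₁ * (prodBernoulli p).real A₂ ≤
      (prodBernoulli p).real A₃ * (prodBernoulli p).real A₄ :=
  prodBernoulli_real_mul_le_of_fibrewise p A₁ A₂ A₃ A₄
    (fun M u _ => FoldingFibre.fibreCount_le_of_fourEvents h M u)

/-- **"Kleitman twice"** — the two-part case of the ordered-partition inequalities: for two lower
sets `𝒟₁, 𝒟₂` of the cube, the number of configurations `a` with `a ∈ 𝒟₁` and `aᶜ ∈ 𝒟₂` (ordered
2-partitions `(a, aᶜ)` of `ι` with the parts in `𝒟₁`, `𝒟₂`) is at most `#(𝒟₁ ∩ 𝒟₂)`.  Instance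
`A₃ = 𝒟₁ ∩ 𝒟₂`, `A₄ = univ` of the fibrewise four events theorem on the fibre `(univ, ∅)`; for `q = 1`
Björner 2011 Thm 3.1 / Kleitman. [cite: Christofides2009, Thm 2.2] [cite: Bjorner2011, Thm 3.1]
[cite: Kleitman1966, Lemma] -/
theorem card_filter_compl_mem_le_of_isLowerSet {𝒟₁ 𝒟₂ : Set (Set ι)} (h₁ : IsLowerSet 𝒟₁)
    (h₂ : IsLowerSet 𝒟₂) :
    (Finset.univ.filter fun a : Set ι => a ∈ 𝒟₁ ∧ aᶜ ∈ 𝒟₂).card ≤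
      (Finset.univ.filter fun a : Set ι => a ∈ 𝒟₁ ∩ 𝒟₂).card := by
  have hyp : ∀ a ∈ 𝒟₁, ∀ b ∈ 𝒟₂, a ∩ b ∈ 𝒟₁ ∩ 𝒟₂ ∧ a ∪ b ∈ (Set.univ : Set (Set ι)) :=
    fun a ha b hb => ⟨⟨h₁ Set.inter_subset_left ha, h₂ Set.inter_subset_right hb⟩, Set.mem_univ _⟩
  have hf := FoldingFibre.fibreCount_le_of_fourEvents hyp Set.univ ∅
  have e1 : (Finset.univ.filter fun a : Set ι =>
      a \ Set.univ = ∅ ∧ a ∈ 𝒟₁ ∧ a ∆ Set.univ ∈ 𝒟₂) =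
      Finset.univ.filter fun a : Set ι => a ∈ 𝒟₁ ∧ aᶜ ∈ 𝒟₂ := by
    ext a
    simp [symmDiff_univ_eq_compl]
  calc (Finset.univ.filter fun a : Set ι => a ∈ 𝒟₁ ∧ aᶜ ∈ 𝒟₂).card
      = (Finset.univ.filter fun a : Set ι =>
          a \ Set.univ = ∅ ∧ a ∈ 𝒟₁ ∧ a ∆ Set.univ ∈ 𝒟₂).card := by rw [e1]
    _ ≤ _ := hf
    _ = (Finset.univ.filter fun a : Set ι => a ∈ 𝒟₁ ∩ 𝒟₂).card := by
        congr 1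
        ext a
        simp [symmDiff_univ_eq_compl]

end Literature.Probability.Percolation

end
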